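import Summits.QuantumFields.YangMills.Theorems.BalabanUVNodesN22W1RelCentredSliceInputsLGU
import Literature.MathematicalPhysics.QuantumFieldTheory.Balaban1983to89.B13TermWalkData

/-!
# BalabanUVNodes ∕ node N22 = NE9 — THE RELATIVE-DISC CENTRED ROAD OVER THE ADMISSIBLE CLASS, MODULE J16: THE KERNEL BLOCK OF THE UNIFORM RECORD `SliceInputsLGU` READ FROM NODE A's
# WALK RECORD AT THE CONFIGURATIONS OF THE THICKENING — the record's located kernel letters (L17a) `hG hΓ₀ hCs hC216`, (L16a) `hdΓ hdC hdE` and the two primitive φ-laws of the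
# kernels `hAd hGd` ([II] (1.5) p. 3), at EVERY configuration `ξ` of the thickening `W`, are THEOREMS for a datum whose kernel record carries ONE walk record `TermWalkData (𝒦 Z t) w`
# ([II] p. 13 ∕ p. 15; [Balaban1985BackgroundPropagators] Thm 3.10) and whose configuration reading `uOf` maps `W` holomorphically into the `α`-ball (dag-n18-c file 27's read-off at
# N18's datum, here at N22's record; the (J1) glue: walk road at `c⁺ = {c with κ₁ := κ₁ + 1}` on the RE-KEYED kernel record, σ-region `ball 0 e^{κ₁+1}`, datum at the knit's `c`)

Cell `pub-ymgap`, HUMAN RULING D-0062 (Track A), R134 ACCELERATION re-seat `pub-ymgap-dag-n22-c` (strategy s1), generation 9, file J16.  THEOREMS ONLY; imports J12-D `…SliceInputsLGU`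
(the uniform ∕ primitive record) and NODE A's record file `B13TermWalkData` (`WalkConsts`, `TermWalkData`, the capstones `localisation17a_of_termWalkData` ∕
`differences216_of_termWalkData`, the joint walk expansions' `JointWalkExpansion.analyticOnBall`) BY NAME; the three-line (J1) glue of the NE5 cell's `TwoRunTorusWalkH226.sigma_region_glue`
is inlined (no Summit-side import outside `YangMills/Theorems`).  `--supports` K3⁷ `SpineGivenEndpointR13SepCoPH` (stmt-QuantumFields-20544) as a helper.

WHY.  After J11–J15 the record `SliceInputsLGU` of the s1 line carries, besides the box block, the Wilson-remainder block, the older-terms LETTERS and the numerics, a KERNEL block: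
the (L17a) ∕ (L16a) letters of NODE A's kernels `A(ξ,σ) = C^{(k)}(Z₀,σ)⁻¹`, `G(σ, uOf ξ)` of `Γ_k(Z₀,σ)` on an open σ-polydisc, UNIFORMLY over the configurations `ξ ∈ W`, and the two
primitive φ-laws `hAd` ∕ `hGd`.  NODE A's typed deliverable for a term is ONE walk record `TermWalkData (𝒦 Z t) w` (joint walk expansions of the Γ-kernel and of the precision, walk
majorants of the covariance, on the `w.R`-ball of configurations, [II] p. 13 ∕ p. 15, [B9] Thm 3.10); dag-n18-c's file 27 read N18's nine kernel binders off it.  THIS FILE is the same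
read-off AT N22's RECORD: at every `ξ ∈ W` with `uOf ξ` in the `α`-ball, (L17a) by `localisation17a_of_termWalkData` (dropped to the rate `κ_b`), (L16a) by `differences216_of_termWalkData`
(given NODE A's symmetry ∕ `Re ≻ 0` of the precision on the closed `c⁺`-polydisc), and the φ-laws by the expansions' analyticity in `u` COMPOSED with the reading map (chain rule).  The
letters become FUNCTIONS OF THE PACKAGE `w`: `Uσ := ball 0 e^{κ₁+1}`, `kap := κ_b`, `K_G = K_Γ := K̄_Γ`, `K_{Cσ} = K₀ := K̄_C`, `θ_Γ := 2K̄_Γ(e^{−εR_σ} + α∕R)`,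
`θ_E := 2K̄_E(e^{−εR_σ} + α∕R)`, `θ_C := K̄_C·θ_E·(m(1+2∕(κ−κ_a))^ν)·K̄_C·(m(1+2∕(κ_a−κ_b))^ν)` — the same for every `ξ ∈ W`, which is the UNIFORMITY the record asks.

WHAT.  ★ `SliceInputsLGU.kernelLaws_of_termWalkData` — for `𝔇 : TermDatum214 c …` (the knit's binder) with `TermWalkData ({(𝔇.𝒦 Z t) with} : TermKernels c⁺ …) w`, `w.Admissible α Rσ₀`, `0 < α`, `DifferentiableOn ℂ (𝔇.uOf Z t) W`,
`MapsTo (𝔇.uOf Z t) W (ball 0 α)`, NODE A's `hAs`∕`hA` on the closed `c⁺`-polydisc at every `ξ ∈ W`, rates `0 ≤ κ_b < κ_a < w.κ`: the CONJUNCTION, in the record's binder shapes at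
`Uσ := ball 0 e^{c.κ₁+1}`, of `IsOpen Uσ`, `closedBall 0 e^{c.κ₁} ⊆ Uσ` (the record's `hUσ` ∕ `hUexp`), `hAd`, `hGd`, `hAs`, `hA`, `hG`, `hΓ₀`, `hCs`, `hC216`, `hdΓ`, `hdC`, `hdE` with the
letters above.  STAY DISPLAYED (said, not hidden): the σ-holomorphy `hAhol` ∕ `hGhol` (NODE O's linear interpolations (2.4)–(2.6); not walk data), the column fibre bound `hfibN`, the
reference letter `hCE` (entrywise decay of `C⁻¹ = A(0,0)`), NODE A's smallness and the mixed numerics (`hθR1le`, `hsmallKθ`, `hαc`, `hsmall`, `hvol`, the primed letters), which couple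
the kernel block to the box ∕ Wilson blocks and are the producer's arithmetic.  THE (J1) GLUE WITHOUT RE-TYPING THE KNIT: the knit J10c ∕ J12-K types the datum family at the ESTIMATE's constants
(`𝔇 : W1.TermData214 c …`), while the walk road runs one unit of `κ₁` above the estimate (the NE5 cell's ∕ dag-n18-c files 26–27 (J1) glue: letters on the CLOSED `e^{κ₁+1}`-polydisc,
the record's OPEN `Uσ` in between); since NO field of NODE A's `TermKernels c …` reads the constants, the kernel record of a datum at `c` is RE-KEYED at `c⁺` by structure update
(`{(𝔇.𝒦 Z t) with} : TermKernels c⁺ …`, definitionally the same kernels) and the walk record is ASKED THERE — so this file's datum binder is the knit's and no landed file changes.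

HONEST FRAMING.  Count-neutral compositions of NODE A's LANDED capstones; NO estimate of Bałaban's is proved here; the walk record, the package, the reading map's laws, the symmetry ∕
positivity of the precision are HYPOTHESES about the datum — whether Bałaban's kernels of record ADMIT such walk records with one package is NODE O's ∕ NODE A's statement, not claimed;
N22 NOT discharged; one finite four-torus programme at fixed ε — NOT infinite volume, NOT OS on ℝ⁴, NOT a mass gap, NOT Clay.  0 `sorry`, 0 `def`, standard axioms.

References (TYPES only): [II] = [Balaban1988RG2Cluster] (1.5) p. 3, (1.11) p. 5, p. 13, (2.14)–(2.16) pp. 15–16 (p. 15 ll. 19–20); [Balaban1985BackgroundPropagators] Thm 3.10 p. 416;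
[I] = [Balaban1987RG1] §1 p. 263.
-/

noncomputable section

namespace YMDAG.N22.W1

open Set Metric Matrix
open Literature.MathematicalPhysics.QuantumFieldTheory.Balaban1983to89
open Literature.MathematicalPhysics.QuantumFieldTheory.Balaban1983to89.TreeLengthTorus (TPt TDom tsys)
open Literature.MathematicalPhysics.QuantumFieldTheory.Balaban1983to89.B9Thm37GlueTorus (tdist1)
open Literature.MathematicalPhysics.QuantumFieldTheory.Balaban1983to89.B5TorusCover (UT)
open Literature.MathematicalPhysics.QuantumFieldTheory.Balaban1983to89.B13PrimitiveKernels216 (Localisation17a Differences216 localisation17a_mono_rate)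
open Literature.MathematicalPhysics.QuantumFieldTheory.Balaban1983to89.B13TermWalkData
  (WalkConsts TermKernels TermWalkData localisation17a_of_termWalkData differences216_of_termWalkData)
open Literature.MathematicalPhysics.QuantumFieldTheory.Balaban1983to89.Node00.Sect2 (domSys domCount CPair)
open Literature.MathematicalPhysics.QuantumFieldTheory.Balaban1983to89.Node00.W1

namespace SliceInputsLGU

variable {c : B13.Consts} {P : Params} {𝔸 : Type*} [NormedRing 𝔸] [NormedAlgebra ℂ 𝔸] {M k L : ℕ} [NeZero L]
  (𝔇 : TermDatum214 c P 𝔸 M k L) (Z : (domSys P M (k + 1)).Dom) (t : TermLabel P M k L)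
  {W : Set (CPair P 𝔸)}

/-- **★ THE KERNEL BLOCK OF THE UNIFORM RECORD FROM NODE A's WALK RECORD, READ AT THE CONFIGURATIONS OF THE THICKENING** — for a (2.14) datum at the ESTIMATE's constants `c` (the knit
J12-K's binder) whose kernel record at the slice `(Z, t)`, RE-KEYED at `c⁺ = {c with κ₁ := κ₁ + 1}` by structure update (no field of `TermKernels` reads the constants), carries a walk record
`TermWalkData ({(𝔇.𝒦 Z t) with} : TermKernels c⁺ …) w` with an admissible package (`α < w.R`, `0 ≤ ε`, `0 < κ`, `K̄ ≥ 0`), whose configuration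
reading maps the thickening `W` holomorphically into the `α`-ball, and whose precision is symmetric with `Re ≻ 0` on the closed `c⁺`-polydisc at every `ξ ∈ W` (NODE A, [II] p. 15),
and rates `0 ≤ κ_b < κ_a < w.κ`: at the σ-region `Uσ := ball 0 e^{c.κ₁+1}` (open, containing the closed `e^{c.κ₁}`-ball — the record's `hUσ`, `hUexp`) the record's kernel fields hold
with letters read off the package — `hAd`, `hGd` (the joint walk expansions' analyticity in the configuration, [B9] Thm 3.10, ∘ the reading map), `hAs`, `hA` (restriction), `hG`, `hΓ₀`,
`hCs`, `hC216` (`localisation17a_of_termWalkData` at `uOf ξ` ∕ at `0`, dropped to `κ_b`), `hdΓ`, `hdC`, `hdE` (`differences216_of_termWalkData` at `uOf ξ`), UNIFORMLY in `ξ ∈ W`.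
[cite: Balaban1988RG2Cluster, (1.5) p.3, p.13, (2.14)-(2.16) pp.15-16; Balaban1985BackgroundPropagators, Thm 3.10 p.416] -/
theorem kernelLaws_of_termWalkData {w : WalkConsts} {α Rσ₀ : ℝ} (hw : w.Admissible α Rσ₀) (hα : 0 < α)
    (h𝒦 : TermWalkData ({ (𝔇.𝒦 Z t) with } : TermKernels ({ c with κ₁ := c.κ₁ + 1 } : B13.Consts) P.d (domCount P M (k + 1)) 𝔇.ν 𝔇.Nf 𝔇.E₃) w)
    (huOf : DifferentiableOn ℂ (𝔇.uOf Z t) W) (hmaps : MapsTo (𝔇.uOf Z t) W (ball (0 : 𝔇.E₃) α))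
    (hAs : ∀ ξ ∈ W, ∀ σ : TPt P.d (domCount P M (k + 1)) → ℂ, (∀ j, ‖σ j‖ ≤ Real.exp (c.κ₁ + 1)) → (𝔇.A Z t ξ σ).IsSymm)
    (hA : ∀ ξ ∈ W, ∀ σ : TPt P.d (domCount P M (k + 1)) → ℂ, (∀ j, ‖σ j‖ ≤ Real.exp (c.κ₁ + 1)) → ((𝔇.A Z t ξ σ).map Complex.re).PosDef)
    {κa κb : ℝ} (hκa : κa < w.kap) (hκb : κb < κa) (hκb0 : 0 ≤ κb) :
    IsOpen (ball (0 : ℂ) (Real.exp (c.κ₁ + 1))) ∧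
    closedBall (0 : ℂ) (Real.exp c.κ₁) ⊆ ball (0 : ℂ) (Real.exp (c.κ₁ + 1)) ∧
    -- hAd, hGd
    (∀ σ : TPt P.d (domCount P M (k + 1)) → ℂ, (∀ j, σ j ∈ ball (0 : ℂ) (Real.exp (c.κ₁ + 1))) → ∀ i j,
        DifferentiableOn ℂ (fun ξ : CPair P 𝔸 => 𝔇.A Z t ξ σ i j) W) ∧
    (∀ σ : TPt P.d (domCount P M (k + 1)) → ℂ, (∀ j, σ j ∈ ball (0 : ℂ) (Real.exp (c.κ₁ + 1))) → ∀ i j,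
        DifferentiableOn ℂ (fun ξ : CPair P 𝔸 => (𝔇.𝒦 Z t).G2 σ (𝔇.uOf Z t ξ) i j) W) ∧
    -- hAs, hA
    (∀ ξ ∈ W, ∀ σ : TPt P.d (domCount P M (k + 1)) → ℂ, (∀ j, σ j ∈ ball (0 : ℂ) (Real.exp (c.κ₁ + 1))) → (𝔇.A Z t ξ σ).IsSymm) ∧
    (∀ ξ ∈ W, ∀ σ : TPt P.d (domCount P M (k + 1)) → ℂ, (∀ j, σ j ∈ ball (0 : ℂ) (Real.exp (c.κ₁ + 1))) → ((𝔇.A Z t ξ σ).map Complex.re).PosDef) ∧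
    -- hG, hΓ₀, hCs, hC216
    (∀ ξ ∈ W, ∀ σ : TPt P.d (domCount P M (k + 1)) → ℂ, (∀ j, σ j ∈ ball (0 : ℂ) (Real.exp (c.κ₁ + 1))) → ∀ b j,
        ‖(𝔇.𝒦 Z t).G2 σ (𝔇.uOf Z t ξ) b j‖ ≤ w.KbarΓ * Real.exp (-(κb * tdist1 𝔇.Nf ((𝔇.𝒦 Z t).locΛ b) ((𝔇.𝒦 Z t).locN j)))) ∧
    (∀ b j, ‖(𝔇.𝒦 Z t).Γ₀ b j‖ ≤ w.KbarΓ * Real.exp (-(κb * tdist1 𝔇.Nf ((𝔇.𝒦 Z t).locΛ b) ((𝔇.𝒦 Z t).locN j)))) ∧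
    (∀ ξ ∈ W, ∀ σ : TPt P.d (domCount P M (k + 1)) → ℂ, (∀ j, σ j ∈ ball (0 : ℂ) (Real.exp (c.κ₁ + 1))) → ∀ b b',
        ‖(𝔇.A Z t ξ σ)⁻¹ b b'‖ ≤ w.KbarC * Real.exp (-(κb * tdist1 𝔇.Nf ((𝔇.𝒦 Z t).locΛ b) ((𝔇.𝒦 Z t).locΛ b')))) ∧
    (∀ b b', ‖(𝔇.𝒦 Z t).C b b'‖ ≤ w.KbarC * Real.exp (-(κb * tdist1 𝔇.Nf ((𝔇.𝒦 Z t).locΛ b) ((𝔇.𝒦 Z t).locΛ b')))) ∧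
    -- hdΓ, hdC, hdE
    (∀ ξ ∈ W, ∀ σ : TPt P.d (domCount P M (k + 1)) → ℂ, (∀ j, σ j ∈ ball (0 : ℂ) (Real.exp (c.κ₁ + 1))) → ∀ b j,
        ‖((𝔇.𝒦 Z t).G2 σ (𝔇.uOf Z t ξ) - (𝔇.𝒦 Z t).Γ₀.map (algebraMap ℝ ℂ)) b j‖ ≤
          (2 * w.KbarΓ * Real.exp (-(w.ε * w.Rσ)) + 2 * w.KbarΓ * α / w.R) * Real.exp (-(κb * tdist1 𝔇.Nf ((𝔇.𝒦 Z t).locΛ b) ((𝔇.𝒦 Z t).locN j)))) ∧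
    (∀ ξ ∈ W, ∀ σ : TPt P.d (domCount P M (k + 1)) → ℂ, (∀ j, σ j ∈ ball (0 : ℂ) (Real.exp (c.κ₁ + 1))) → ∀ b b',
        ‖((𝔇.A Z t ξ σ)⁻¹ - (𝔇.𝒦 Z t).C.map (algebraMap ℝ ℂ)) b b'‖ ≤
          (w.KbarC * (2 * w.KbarE * Real.exp (-(w.ε * w.Rσ)) + 2 * w.KbarE * α / w.R)
            * ((𝔇.𝒦 Z t).m * (1 + 2 / (w.kap - κa)) ^ 𝔇.ν) * w.KbarC * ((𝔇.𝒦 Z t).m * (1 + 2 / (κa - κb)) ^ 𝔇.ν)) *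
          Real.exp (-(κb * tdist1 𝔇.Nf ((𝔇.𝒦 Z t).locΛ b) ((𝔇.𝒦 Z t).locΛ b')))) ∧
    (∀ ξ ∈ W, ∀ σ : TPt P.d (domCount P M (k + 1)) → ℂ, (∀ j, σ j ∈ ball (0 : ℂ) (Real.exp (c.κ₁ + 1))) → ∀ b b',
        ‖(𝔇.A Z t ξ σ - (𝔇.𝒦 Z t).C⁻¹.map (algebraMap ℝ ℂ)) b b'‖ ≤
          (2 * w.KbarE * Real.exp (-(w.ε * w.Rσ)) + 2 * w.KbarE * α / w.R) * Real.exp (-(κb * tdist1 𝔇.Nf ((𝔇.𝒦 Z t).locΛ b) ((𝔇.𝒦 Z t).locΛ b')))) := by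
  -- the (J1) glue: the open σ-region of radius `e^{κ₁+1}` between the closed `c`- and `c⁺`-polydiscs
  have hUexp : closedBall (0 : ℂ) (Real.exp c.κ₁) ⊆ ball (0 : ℂ) (Real.exp (c.κ₁ + 1)) :=
    closedBall_subset_ball (Real.exp_lt_exp.2 (by linarith))
  have hcl : ∀ σ : TPt P.d (domCount P M (k + 1)) → ℂ, (∀ j, σ j ∈ ball (0 : ℂ) (Real.exp (c.κ₁ + 1))) →
      ∀ j, ‖σ j‖ ≤ Real.exp ({ c with κ₁ := c.κ₁ + 1 } : B13.Consts).κ₁ := fun σ hσ j => (mem_ball_zero_iff.1 (hσ j)).le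
  have hcl' : ∀ σ : TPt P.d (domCount P M (k + 1)) → ℂ, (∀ j, σ j ∈ ball (0 : ℂ) (Real.exp (c.κ₁ + 1))) →
      ∀ j, ‖σ j‖ ≤ Real.exp (c.κ₁ + 1) := fun σ hσ j => (mem_ball_zero_iff.1 (hσ j)).le
  have hκbw : κb ≤ w.kap := (hκb.trans hκa).le
  have hR0 : 0 < w.R := hα.trans hw.hαR
  have huα : ∀ ξ ∈ W, ‖𝔇.uOf Z t ξ‖ ≤ α := fun ξ hξ => (mem_ball_zero_iff.1 (hmaps hξ)).le
  have huR : ∀ ξ ∈ W, 𝔇.uOf Z t ξ ∈ ball (0 : 𝔇.E₃) w.R := fun ξ hξ => ball_subset_ball hw.hαR.le (hmaps hξ)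
  have hmapsR : MapsTo (𝔇.uOf Z t) W (ball (0 : 𝔇.E₃) w.R) := hmaps.mono_right (ball_subset_ball hw.hαR.le)
  -- L17a at every configuration of the thickening (dropped to `κb`), and at `u = 0` for the `u`-free references `Γ₀`, `C`
  have h17 : ∀ ξ ∈ W, Localisation17a ({ c with κ₁ := c.κ₁ + 1 } : B13.Consts) (fun σ => (𝔇.𝒦 Z t).A2 σ (𝔇.uOf Z t ξ))
      (fun σ => (𝔇.𝒦 Z t).G2 σ (𝔇.uOf Z t ξ)) (𝔇.𝒦 Z t).Γ₀ (𝔇.𝒦 Z t).C (𝔇.𝒦 Z t).locΛ (𝔇.𝒦 Z t).locN κb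
      w.KbarΓ w.KbarΓ w.KbarC w.KbarC := fun ξ hξ =>
    localisation17a_mono_rate hκbw hw.hKbarΓ hw.hKbarΓ hw.hKbarC hw.hKbarC (localisation17a_of_termWalkData hw hα.le h𝒦 (huR ξ hξ))
  have h17₀ : Localisation17a ({ c with κ₁ := c.κ₁ + 1 } : B13.Consts) (fun σ => (𝔇.𝒦 Z t).A2 σ 0)
      (fun σ => (𝔇.𝒦 Z t).G2 σ 0) (𝔇.𝒦 Z t).Γ₀ (𝔇.𝒦 Z t).C (𝔇.𝒦 Z t).locΛ (𝔇.𝒦 Z t).locN κb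
      w.KbarΓ w.KbarΓ w.KbarC w.KbarC :=
    localisation17a_mono_rate hκbw hw.hKbarΓ hw.hKbarΓ hw.hKbarC hw.hKbarC (localisation17a_of_termWalkData hw hα.le h𝒦 (mem_ball_self hR0))
  -- L16a at every configuration of the thickening (NODE A's `hAs hA`)
  have h16 : ∀ ξ ∈ W, Differences216 ({ c with κ₁ := c.κ₁ + 1 } : B13.Consts) (fun σ => (𝔇.𝒦 Z t).A2 σ (𝔇.uOf Z t ξ))
      (fun σ => (𝔇.𝒦 Z t).G2 σ (𝔇.uOf Z t ξ)) (𝔇.𝒦 Z t).Γ₀ (𝔇.𝒦 Z t).C (𝔇.𝒦 Z t).locΛ (𝔇.𝒦 Z t).locN κb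
      (2 * w.KbarΓ * Real.exp (-(w.ε * w.Rσ)) + 2 * w.KbarΓ * α / w.R)
      (w.KbarC * (2 * w.KbarE * Real.exp (-(w.ε * w.Rσ)) + 2 * w.KbarE * α / w.R)
        * ((𝔇.𝒦 Z t).m * (1 + 2 / (w.kap - κa)) ^ 𝔇.ν) * w.KbarC * ((𝔇.𝒦 Z t).m * (1 + 2 / (κa - κb)) ^ 𝔇.ν))
      (2 * w.KbarE * Real.exp (-(w.ε * w.Rσ)) + 2 * w.KbarE * α / w.R) := fun ξ hξ =>
    differences216_of_termWalkData hw hα.le h𝒦 hκb0 hκb hκa (huα ξ hξ) (hAs ξ hξ) (hA ξ hξ)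
  -- holomorphy IN THE CONFIGURATION: the joint walk expansions' analyticity in `u` ∘ the reading map (chain rule)
  obtain ⟨WΓ, TΓ, SXΓ, AΓ, DΓ, ρΓ, hΓw⟩ := h𝒦.hΓ
  obtain ⟨WE, TE, SXE, AE, DE, ρE, hEw⟩ := h𝒦.hE
  refine ⟨isOpen_ball, hUexp, fun σ hσ i j => ?_, fun σ hσ i j => ?_, fun ξ hξ σ hσ => hAs ξ hξ σ (hcl' σ hσ),
    fun ξ hξ σ hσ => hA ξ hξ σ (hcl' σ hσ), fun ξ hξ σ hσ => (h17 ξ hξ).hG σ (hcl σ hσ), h17₀.hΓ₀,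
    fun ξ hξ σ hσ => (h17 ξ hξ).hCs σ (hcl σ hσ), h17₀.hC216, fun ξ hξ σ hσ => (h16 ξ hξ).hdΓ σ (hcl σ hσ),
    fun ξ hξ σ hσ => (h16 ξ hξ).hdC σ (hcl σ hσ), fun ξ hξ σ hσ => (h16 ξ hξ).hdE σ (hcl σ hσ)⟩
  · exact ((hEw.analyticOnBall hw.hε) σ (hcl σ hσ) i j).comp huOf hmapsR
  · exact ((hΓw.analyticOnBall hw.hε) σ (hcl σ hσ) i j).comp huOf hmapsR

end SliceInputsLGU

end YMDAG.N22.W1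

end
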